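import Mathlib
import HarnessLib
import HarnessLib.Audit
import Summits.MatrixMultiplication.Statement
import Literature.Computability.AlgebraicComplexity.SchoenhageTau
import Literature.Computability.AlgebraicComplexity.ArithCircuit
import HarnessLib.Audit.Status.Attr

/-!
Route: HiddenToeplitzCorners

DORMANT since 2026-08-25T03:41:26Z (reconciler: no traction for 7.3 d (last activity item-evidence-added at 2026-08-17T18:58:51Z); parked, not closed — `ledger route dormant route-MatrixMultiplication-HiddenToeplitzCorners --off` to rea) — unstaffed, not closed; items shared with open routes are served there. `ledger route dormant <id> --off` reactivates.

# Route HiddenToeplitzCorners — omega = 2 if a generic r x r corner hides in a Toeplitz-like pencil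
of size r^(2+o(1)) — Andrews lifting x omega-free superfast elimination

It suffices to show X = HiddenCorners (card structured-determinantal-witnesses-hidden-corner, its
thesis HC made
precise for the Toeplitz-like class): for every ε > 0 there are infinitely many r admitting a linear
pencil
T(X) = Σ_ab X_ab T_ab of N x N complex matrices, N <= r^(2+ε), which (i) is TOEPLITZ-LIKE with
short, sparse
generators — T(X) − Z T(X) Zᵀ = G₀ H₁(X)ᵀ + G₁(X) H₀ᵀ with Z the lower shift, G₀, H₀ constant N x d,
G₁, H₁ linear
in X with at most r^(2+ε) nonzero coefficients, d <= r^ε (Stein displacement rank <= 2d;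
Kailath–Kung–Morf) —
(ii) is generically nonsingular, det T(X₀) ≠ 0, and (iii) is singular whenever X is singular. Then
f_r := det∘T is a
nonzero element of the principal determinantal ideal (det_r), and two literature theorems do the
rest: omega-free superfast elimination (Bitmead–Anderson/Morf 1980, Kaltofen 1994, Pan 2001 Cor.
5.3.3; NOT yet in the
tree — since the cone repair of 2026-08-15 the route's ONE remaining unproved literature input)
prices a nonzero
polynomial multiple of f_r at (d²N + sparsity)·r^(o(1)) = r^(2+O(ε)) division-free gates (crux
ToeplitzLikeDetCost), and
Andrews' lifting theorem (arXiv:2208.01078 Thm 3; PROVED in the tree since 2026-08-15T15:43Z as the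
Literature discharge
`Andrews2022_thm3_holds`) turns any nonzero member of (det_r) of complexity s into
bR(⟨⌊r/4⌋,⌊r/4⌋,⌊r/4⌋⟩) <= 6s (AndrewsLifting — re-badged support, provable now, at the cone repair;
it was crux #2); Bini's theorem (Blaser2013_thm66, PROVED in tree) and omega_two_le
give ω(ℂ) = 2. The card's predicted obstruction, the hidden-corner lemma (d >= r/2 for linearly
explained corners), is filed, in its
non-degenerate form (generically nonsingular pencils, as HiddenCorners itself demands), as the
negative-side crux
HiddenCornerLemmaR — the unguarded form HiddenCornerLemma was refuted as typed by a singular (r,N,d)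
= (3,9,1) witness and
dropped at rev 2; the r = 2 Toeplitz proof of concept and the corner criterion are supports.
Lean: `∀ ε : ℝ, 0 < ε → ∃ᶠ r : ℕ in Filter.atTop, ∃ (N d : ℕ), (N : ℝ) ≤ (r : ℝ) ^ (2 + ε) ∧ (d : ℝ)
≤ (r : ℝ) ^ ε ∧ ∃ (T : Fin r → Fin r → Matrix (Fin N) (Fin N) ℂ) (G₀ H₀ : Matrix (Fin N) (Fin d) ℂ)
(G₁ H₁ : Fin r → Fin r → Matrix (Fin N) (Fin d) ℂ), (∀ a b, T a b - (Matrix.of fun i j : Fin N => if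
(i : ℕ) = (j : ℕ) + 1 then (1 : ℂ) else 0) * T a b * (Matrix.of fun i j : Fin N => if (i : ℕ) = (j :
ℕ) + 1 then (1 : ℂ) else 0)ᵀ = G₀ * (H₁ a b)ᵀ + G₁ a b * H₀ᵀ) ∧ ((∑ a : Fin r, ∑ b : Fin r,
((Finset.univ.filter fun p : Fin N × Fin d => G₁ a b p.1 p.2 ≠ 0).card + (Finset.univ.filter fun p :
Fin N × Fin d => H₁ a b p.1 p.2 ≠ 0).card) : ℕ) : ℝ) ≤ (r : ℝ) ^ (2 + ε) ∧ (∃ X₀ : Matrix (Fin r)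
(Fin r) ℂ, (∑ a : Fin r, ∑ b : Fin r, X₀ a b • T a b).det ≠ 0) ∧ ∀ X : Matrix (Fin r) (Fin r) ℂ,
X.det = 0 → (∑ a : Fin r, ∑ b : Fin r, X a b • T a b).det = 0`

## Assembly
Pure logic from the two glue supports (sorry-free in Sketch.lean: `assembly_of_glue : CostGlue →
LiftGlue → Assembly`):
ToeplitzLikeDetCost and HiddenCorners give CheapIdealMembers (CostGlue: Nullstellensatz for the
prime ideal (det_r) +
cost bookkeeping), and AndrewsLifting turns CheapIdealMembers into bR(⟨q,q,q⟩) <= C q^(2+ε) along an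
unbounded set of q,
whence ω(ℂ) = 2 by Bini's theorem Blaser2013_thm66_holds and omega_two_le, both PROVED cone facts
(LiftGlue).
HiddenCornerLemmaR is the negative side and is deliberately NOT a hypothesis of the assembly (nor of
`closes`).

Rationale: WHY THIS LINE. Two facts that have never met are combined (card
structured-determinantal-witnesses-hidden-corner; companion card
determinantal-ideal-lifting-division-free-omega owns the general "cheapest ideal member has exponent
ω" face):
(F1) Andrews2022 Thm 3 (held text p. 11, char 0; PROVED in tree 2026-08-15T15:43Z as Literature
`Andrews2022_thm3_holds`,
DeterminantalIdealComplexityProofs.lean, built on AndrewsForbes2022_prop_3_5_holds) prices EVERY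
nonzero element of the determinantal ideal I^det_(n,m,r)
at border multiplicative complexity >= bR(r/4)/6, so one cheap nonzero multiple of det_r per r, for
infinitely many r,
gives ω = 2 through Bini (in tree); (F2) elimination on Toeplitz-like matrices of displacement rank
α is ω-FREE —
determinant in Õ(α²N) field operations given generic rank profile (Pan2001 Cor. 5.3.3,
BitmeadAnderson1980,
Kaltofen1994; KarpmanEtAl2021 §1 for the modern statement; Õ(α^(ω−1)N) in BostanJeannerodSchost2008,
BostanEtAl2017),
by FFT polynomial arithmetic with no matrix multiplication inside; divisions are removed at constant
factor by
numerator/denominator simulation (Strassen1973), which keeps the output inside the ideal. Imported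
areas: displacement
structure / structured numerical linear algebra (KailathKungMorf1979, HeinigRost1984, Pan2001),
algebraic
derandomisation (Andrews2022, AndrewsForbes2022), and linear preserver problems / spaces of bounded
rank (Dieudonne1948,
Flanders1962, EisenbudHarris1988, arXiv:1002.1732) for the obstruction side. What no prior route
does: every open
route on this summit works with tensor decompositions, asymptotic spectra, STPP designs or secant
equations; here the
final algorithm for ⟨n,n,n⟩ would be extracted by Baur–Strassen from an FFT-based structured
determinant, a class none
of the catalogued barriers addresses, and the whole MaMu content is concentrated in one
finite-dimensional
linear-algebra existence question per r (hidden corners), with an exact data point (r,N,d) =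
(2,4,1): the honest 4 x 4
Toeplitz pencil [[0,x22,x12,0],[x11,0,x22,x12],[x21,x11,0,x22],[0,x21,x11,0]] has det = (det X)²
(verified exactly on
the full 5⁴ grid in this session). Negatives index: empty at filing.

RANKED CRUXES. Since the cone repair of 2026-08-15 the route has THREE cruxes — #3
ToeplitzLikeDetCost (now top-ranked; the route's one remaining unproved literature input,
needs-fact: ToeplitzLikeDetCost), #4 HiddenCorners (X), #5 HiddenCornerLemmaR (negative side) —
ranks kept as filed; AndrewsLifting left the crux list because its literature fact was proved in the
tree.
AndrewsLifting (support, provable-now; was crux #2 = card face F1, "the unproved cone fact, filed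
FIRST per Phase-C policy", until its Literature fact `Andrews2022_thm3` was DISCHARGED at
2026-08-15T15:43Z — `Andrews2022_thm3_holds`, 0 sorry — the item being that fact at F := ℂ, n = m =
r, det_r ∣ f ⇒ f ∈ detIdeal; 4-line derivation machine-checked, axioms {propext, Classical.choice,
Quot.sound}, attached to stmt-7490 as Scratch7490.lean next to the grounders' reduction G7490.lean;
twin of DeterminantalIdealExponent's AndrewsLifting stmt-7709) — Andrews' lifting theorem in tree
form: for every r and every nonzero f ∈ ℂ[X_ij : i,j < r] divisible by det X, the border rank of
⟨⌊r/4⌋,⌊r/4⌋,⌊r/4⌋⟩ is at most 6 · complexity f, where complexity is the tree's fan-in-two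
division-free circuit size (ArithCircuit.lean; it dominates the number of product gates, hence
Andrews' border multiplicative complexity). [difficulty: provable-now] (former why-it-might-fail,
now void: "risk is transcription only … a Lean proof needs Andrews–Forbes Lemma 8, the
ε-perturbation Prop. and border Baur–Strassen — sizable" — all of it landed in Literature:
BideterminantReductionProofs, TraceGadgetMatrix/Trace, AndrewsReduction, Nonscalar*,
DeterminantalIdealComplexityProofs.) [Andrews2022, arXiv:2208.01078, AndrewsForbes2022,
BaurStrassen1983, Blaser2013]
#3 ToeplitzLikeDetCost (crux, top-ranked since the cone repair) — omega-free superfast elimination,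
division-free output form (card face F2; the route's ONE remaining unproved cone fact — a composite
of printed algorithms with no single vendorable theorem (grounders g18-8/g18-5: Pan2001 Cor 5.3.3 +
KaltofenSaunders1991 Thm 2 + Strassen1973), hence carried as an in-route crux, not a Literature
decl; needs-fact: ToeplitzLikeDetCost): for every ε > 0 and all large r, every pencil T(X) = Σ X_ab
T_ab of N x N matrices, N <= r³, given with split Stein generators T_ab − Z T_ab Zᵀ = G₀ (H₁)_abᵀ +
(G₁)_ab H₀ᵀ (G₀, H₀ ∈ ℂ^(N x d) constant; s = total number of nonzero entries of the (G₁)_ab,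
(H₁)_ab), admits a nonzero polynomial Q with complexity(Q · det T(X)) <= (d²N + s) · r^ε. Proof in
print: evaluate generators (s gates), precondition with constant unit-triangular Toeplitz
multipliers for generic rank profile over ℂ(X) (KaltofenSaunders1991, Kaltofen1994), MBA
divide-and-conquer on generators with det read off the recursive Schur complements in Õ(d²N) ops
with division (Pan2001 Cor. 5.3.3, BitmeadAnderson1980; KarpmanEtAl2021 §1), then
numerator/denominator simulation (Strassen1973) gives a division-free circuit for (P, Q), P = Q·det,
of <= 4x the length; logs absorbed in r^ε since N <= r³. [difficulty: XL] (why it might fail: In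
print but never assembled in this form: leading minors of a POLYNOMIAL pencil can vanish identically
(the r=2 example has zero diagonal), so preconditioning lives inside the proof; Stein (Z,Zᵀ) vs
Pan/Kaltofen's Z_1/Z_0 operators shift d by O(1); XL to formalise.) [Pan2001, BitmeadAnderson1980,
Kaltofen1994, KaltofenSaunders1991, KarpmanEtAl2021, BostanJeannerodSchost2008, Strassen1973,
KailathKungMorf1979]
#4 HiddenCorners (crux) — X itself (card thesis HC for the Toeplitz-like class): for every ε > 0,
for infinitely many r, there is a Toeplitz-like pencil T : M_r(ℂ) → M_N(ℂ), N <= r^(2+ε), with split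
Stein generators of length d <= r^ε and sparsity <= r^(2+ε), generically nonsingular, and singular
on every singular X. Any construction via the corner criterion T(X)E = FX (support CornerCriterion)
qualifies; the r = 2 honest-Toeplitz instance (N,d) = (4,1) is support ToeplitzCornerTwo; for r >= 3
monomial window frames provably stop, so non-monomial frames (Toeplitz operators with prescribed
structured kernels, HeinigRost1984) or two-companion algebras are needed. [deps: AndrewsLifting,
ToeplitzLikeDetCost] [difficulty: open-problem] (why it might fail: Parameter count: (*) imposes
N·r³ bilinear equations on ~r²·N·d unknowns, so generic solvability needs d ≳ r (the r=2 PoC sits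
exactly on that line) and the card's hidden-corner lemma predicts d >= r/2 for every linearly
explained corner: structure would then be exactly neutral.) [KailathKungMorf1979, HeinigRost1984,
EisenbudHarris1988, Dieudonne1948, Flanders1962, arXiv:1002.1732, Andrews2022]
#5 HiddenCornerLemmaR (crux; supersedes HiddenCornerLemma, refuted as typed at (r,N,d) = (3,9,1) by
a pencil with det T ≡ 0 — refuter evidence R7493Mono.lean on stmt-7493 — and dropped at rev 2) — the
card's predicted obstruction HCL, negative side, Stein form, for GENERICALLY NONSINGULAR pencils
(det T(X₀) ≠ 0 for some X₀): if a pencil T(X) = Σ X_ab T_ab of N x N matrices hides a linearly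
explained r x r corner — T(X)E = FX for all X with constant E, F ∈ ℂ^(N x r) of rank r — and has
Stein displacement rank rank(T(X) − Z T(X) Zᵀ) <= d for every X, then r <= 2d. Proved on the card in
the invariant case im(Z E) ⊆ im(E) (then rank F <= 2d); checked here by a z-adic valuation argument
for (r,d) = (2,1). Its proof kills every compression-type construction of HiddenCorners with d =
r^(o(1)) and is a new linear-preserver theorem ("singularity-preserving linear maps M_r →
Toeplitz-like M_N cannot have displacement rank below r/2"); its refutation at 2d < r exhibits a
genuinely economical hidden corner. [difficulty: L] (why it might fail: The general case resisted a
Krylov-flag argument (garbage rank grows like k·d along Z^k E and the flag can have depth ~N/r); a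
counterexample with 2d < r would itself be the loophole the route bets on — either outcome is
informative, neither is in print.) [Dieudonne1948, Flanders1962, EisenbudHarris1988,
arXiv:1002.1732, arXiv:1004.2467, KailathKungMorf1979, HeinigRost1984,
doi:10.1007/s00029-026-01137-x]
#9 CornerCriterion (support) — the corner criterion (card, "proved, 3 lines"): if E ∈ ℂ^(N x r) has
rank r and T(X)E = FX for all X, then T(X) is singular whenever X is (a kernel vector v of X gives
the kernel vector Ev ≠ 0 of T(X)). Provable now (Matrix.rank, mulVec, det = 0 iff non-injective).
[difficulty: provable-now] [Dieudonne1948, Flanders1962]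
#9 ToeplitzCornerTwo (support) — the r = 2 proof of concept (card PoC, N = 4, F₁ = z, F₂ = z²): the
honest Toeplitz pencil T(X) = [[0,x22,x12,0],[x11,0,x22,x12],[x21,x11,0,x22],[0,x21,x11,0]] has
split Stein generators of length 1 (first row / first column), satisfies T(X)[e₀ e₃] = [e₁ e₂]X, and
det T(X) = (det X)²; verified exactly in this session (5⁴ grid). Anchors HiddenCorners at (r,N,d) =
(2,4,1). [difficulty: provable-now] [KailathKungMorf1979, Andrews2022]
#9 ToeplitzCornerThree (support) — the card's cheapest experiment C1 as a statement (probe, either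
answer informative): some Toeplitz-like pencil of honest displacement rank <= 2 and size N <= 12
hides a linearly explained generic 3 x 3 corner (rank-3 frames E, F with T(X)E = FX, det T(X₀) ≠ 0).
For each candidate frame E the condition is LINEAR in the symbols, so a kit search over ℚ is hours
of exact linear algebra; a witness is Lean-certifiable by the criterion plus one numeric
determinant. HiddenCornerLemmaR permits it (3 <= 4), the generic count forbids it. [difficulty: M]
[KailathKungMorf1979, HeinigRost1984, Pan2001]
#9 CheapIdealMembers (support) — the glue target shared with the companion card's positive face: for
every ε > 0, for infinitely many r, some nonzero f divisible by det X in ℂ[X_ij] has division-free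
complexity <= r^(2+ε). (HiddenCorners ∧ ToeplitzLikeDetCost give it via Hilbert's Nullstellensatz
for the prime (det_r), tree file DeterminantIrreducible; with AndrewsLifting it gives ω = 2.)
[difficulty: open-problem] [Andrews2022, AndrewsForbes2022]
#9 CostGlue (support) — ToeplitzLikeDetCost → HiddenCorners → CheapIdealMembers: take ε' =
min(ε,1)/8, an HC instance at (r, ε') with r past the DetCost threshold for ε'; f := Q · det T(X) is
nonzero (evaluation at X₀, RingHom.map_det) and divisible by det X because det T(X) vanishes on the
zero set of the irreducible det X (Nullstellensatz, MvPolynomial.vanishingIdeal_zeroLocus_eq_radical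
+ DeterminantIrreducible); cost (d²N + s)·r^ε' <= r^(2+ε). [difficulty: provable-now] [Andrews2022,
Blaser2013]
#9 LiftGlue (support) — AndrewsLifting → CheapIdealMembers → ω(ℂ) = 2: with q = ⌊r/4⌋ >= 2 and r <=
6q, bR(⟨q,q,q⟩) <= 6 r^(2+ε) <= 6·6³·q^(2+ε); Bini (Blaser2013_thm66_holds, PROVED) gives ω <=
log_q(1296) + 2 + ε along an unbounded set of q, hence ω <= 2 + ε for every ε, and omega_two_le
(PROVED) closes ω(ℂ) = 2 = MatrixMultiplication. [difficulty: provable-now] [Blaser2013,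
Andrews2022, BurgisserClausenShokrollahi1997]

TWO-LAYER PLAN. Foreseen glued splits (k <= 3, depth 1), filed only when a crux closes or stalls
with a census:
HiddenCorners ⇐ FrameDesign (for infinitely many r, rank-r frames E and symbol families solving the
window-orthogonality
system trunc(τ_ab · ε_j) = δ_bj F_a with d = r^(o(1)) and sparsity r^(2+o(1))) →
GenericNonsingularity (det T(X₀) ≠ 0 for
the designed family) → HiddenCorners, via CornerCriterion. AndrewsLifting needs no split any more:
F1 is proved in Literature (AF22 Prop 3.5 straightening = BideterminantReductionProofs,
Lemma 8 gadget = TraceGadgetMatrix/Trace, Prop 2 = AndrewsReduction, Baur–Strassen + Lemma 7 =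
Nonscalar*, assembled in
DeterminantalIdealComplexityProofs as Andrews2022_thm3_holds); the item is a 4-line corollary.
ToeplitzLikeDetCost ⇐ GenericRankProfile (constant unit-triangular Toeplitz preconditioners over
ℂ(X)) → MBADeterminant
(generator recursion with divisions, Õ(d²N)) → ToeplitzLikeDetCost (numerator/denominator simulation
as glue).
If HiddenCornerLemmaR is proved, HiddenCorners is re-aimed (restate) at NON-compression singularity
preservers
(Eisenbud–Harris primitive spaces) or at operator pairs outside the Toeplitz-like class that still
admit ω-free solvers.

KILL CRITERIA. A proof of ¬HiddenCorners in the strong form "d·N >= c·r³ for every Toeplitz-like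
singularity-preserving pencil with
det ≢ 0" closes the route `refuted:HiddenCorners` with census "displacement structure is exactly
ω-neutral" (a clean
entry for the barrier catalogue). A proof of HiddenCornerLemmaR kills every compression-type
(criterion (*)) construction
at d = r^(o(1)): pivot HiddenCorners to non-linearly-explained preservers or close `exhausted` if no
such example exists
at r <= 4. AndrewsLifting can no longer be refuted (proved in tree, candidate attached);
ToeplitzLikeDetCost refuted = a transcription
error of published algorithms: repair by restate, never a close. CheapIdealMembers proved by any
other construction (companion card) moots HiddenCorners but proves the
summit anyway; ω = 2 proved elsewhere moots the route.

NOT DECOMPOSED YET. The frame-design system for r >= 3 (which operator algebra: honest Toeplitz d <=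
2, two companion algebras ℂ[C_W],
ℂ[C_W'] with d <= 4, Toeplitz-plus-Hankel), the choice between Stein and Sylvester displacement
(they differ by O(1) in
d and are interchangeable here), the constants in the MBA recursion and the FFT cost model inside
ArithCircuit, the
Nullstellensatz bookkeeping of CostGlue, and the Hankel/Cauchy/Vandermonde-like variants (equivalent
to Toeplitz-like up
to constant two-sided multipliers, which preserve everything in HiddenCorners) — all layer-2
children or prover lemmas.
Multilevel Toeplitz and Cauchy-like operators with repeated nodes are deliberately OUT of scope: no
ω-free solver is known
for them (free blocks cost m^ω), so they cannot carry the mechanism.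

CHEAPEST FALSIFIER. Run the card's C1 (= support ToeplitzCornerThree) as a kit job: for r = 3, N <=
12, honest displacement rank <= 2, loop
over candidate frames E (CRT-type polynomial frames ε_j = W/w_j up to symmetry) and solve the LINEAR
system (*) for the
nine symbols, then test det T(X₀) ≠ 0 at a random rational point — hours of exact linear algebra; a
YES refutes HiddenCornerLemmaR's spirit at (3,2) and puts a second point under the generic-count
line, a NO for all N <= 12 supports
HCL. Not run in this session (planner seat, hub compute-free; the r = 2 identity det T = (det X)²
WAS verified exactly
here). Second-cheapest: a literature proof of HCL from compression-space theorems (Flanders1962 /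
EisenbudHarris1988 /
doi:10.1007/s00029-026-01137-x) — a one-afternoon lookup for a refuter.

NUMBERS. bR(⟨n,n,n⟩) >= 2n² − log₂n − 1 (Landsberg–Michałek 2018, quoted Andrews2022 Thm 2); every
nonzero f ∈ I^det_r has border
multiplicative complexity >= r²/48 − (log₂r)/6 + 1/6 (Andrews2022 Cor. 1) and >= bR(r/4)/6 (Thm 3).
Structured
elimination: det of an N x N Toeplitz-like matrix of displacement rank α in Õ(α²N) ops with generic
rank profile (Pan2001
Cor. 5.3.3), Õ(α^(ω−1)N) in general (BostanJeannerodSchost2008, BostanEtAl2017; KarpmanEtAl2021 §1).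
Division-free
determinant: O(n^2.698) (Kaltofen–Villard 2005, calibration only). Data point: (r,N,d,s) =
(2,4,1,≈6) honest Toeplitz,
det T = (det X)². Generic count for criterion (*): unknowns ≈ r²Nd vs equations Nr³ (critical line d
≈ r; the PoC sits on
it); HCL predicts d >= r/2. Budget for ω = 2: N <= r^(2+ε), d <= r^ε, sparsity <= r^(2+ε). Items at
open: 11 (4 cruxes); after the 2026-08-15 repairs (refuted HiddenCornerLemma → HiddenCornerLemmaR;
cone repair):
11 items, 3 cruxes (ToeplitzLikeDetCost, HiddenCorners, HiddenCornerLemmaR), AndrewsLifting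
support/provable-now; gate deps
audit at rev 5: 35 project constants in the cone, 0 unproved (the only witness-less closed Props are
the target side,
MatrixMultiplication and Literature…MatrixMultiplication := omega ℂ = 2); imports SchoenhageTau
(algBorderRank, matMulTensor)
and ArithCircuit (complexity) both load-bearing, none dropped.

DEFINITION REQUESTS. None filed: displacement structure, the shift Z, generators and sparsity are
inlined with Mathlib's Matrix API;
border rank is the tree's algBorderRank (SchoenhageTau.lean), circuit cost the tree's complexity
(ArithCircuit.lean),
the generic matrix Matrix.mvPolynomialX. Candidates for later vendoring (not needed by any item as
filed): a Literature
notion `steinDisplacementRank` / `IsToeplitzLike` and `borderMulComplexity` (Andrews2022 Def. 1) in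
Literature/Computability/AlgebraicComplexity; a cite fact for Pan2001 Cor. 5.3.3. Bib keys added
this session:
Andrews2022, KarpmanEtAl2021, Pan2001, Kaltofen1994, KaltofenSaunders1991,
BostanJeannerodSchost2008, BostanEtAl2017,
KailathKungMorf1979, BitmeadAnderson1980, Dieudonne1948, EisenbudHarris1988, HeinigRost1984 (commit
a880f7321563).

Novelty: Searches (2026-08-15): `lit search --hybrid "Toeplitz-like matrix determinant divisible by
determinant of hidden submatrix singularity preserving linear pencil"` (12 textbook hits: Golub–Van
Loan, Horn–Johnson, Bernstein — nothing on structured singularity preservers); `lit search --source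
zbmath "linear maps preserving singular matrices"` (20 general preserver papers: Šemrl, Li–Poon,
Costara — none into structured or larger spaces with displacement constraints); `lit search --source
zbmath "Toeplitz determinantal representation"` (15, Chien–Nakazato numerical-range representations,
unrelated); `lit galaxy search "displacement rank" --star all` (31 rows: Kailath–Sayed *Fast
Reliable Algorithms for Matrices with Structure*, Pan *Parallel complexity … Toeplitz-like*, and
KarpmanEtAl2021 — read, §1 page-checked for the Õ(α²N)/Õ(α^(ω−1)N) determinant costs and the
rank-regularisation references); `lit frontier MatrixMultiplication --since 2022` (30 rows; only
doi:10.1007/s00029-026-01137-x "On linear spaces of matrices of bounded rank" bears on HCL; nothing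
joins displacement structure to ω); `lit bridges MatrixMultiplication --cross any` (30 rows,
textbooks/surveys only); Andrews2022 held text grep 'Toeplitz|displacement|structured' (nil,
confirmed by the card's refuter). OpenAlex/S2/arXiv APIs were rate-limited (429) in this session —
flag for the novelty audit: a 2023–2026 follow-up of Andrews2022 on structured ideal members has not
been excluded online.
Nearest prior art foun  [refs: 10.1007/s00029-026-01137-x, 2208.01078, 1002.1732, doi:10.1007/s00029-026-01137-x, KarpmanEtAl2021, Andrews2022, Pan2001, BostanJeannerodSchost2008, Kaltofen1994, Dieudonne1948, Flanders1962, EisenbudHarris1988]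

Barriers (technique_class: structured-elimination, determinantal-ideal, preservers): - technique_class: structured-elimination, determinantal-ideal, preservers
- Literature.Barriers.MatrixMultiplication.InfimumNotMinimumBarrier: evaded by construction —
HiddenCorners is a family over infinitely many r and each instance certifies only the inequality
bR(⟨⌊r/4⌋⟩) <= 6·C(f_r), which improves with r; no single finite algorithm is asked to certify ω = 2
(the assembly goes through Bini along an unbounded set of q).
- Literature.Barriers.MatrixMultiplication.LinearRankMethodBarrier: not applicable — an upper-bound
mechanism; the only lower-bound-flavoured item, HiddenCornerLemma, is a statement about linear
singularity preservers into Toeplitz-like spaces, not a determinantal equation for a secant variety.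
- Literature.Barriers.MatrixMultiplication.IrreversibilityBarrier: not applicable — no intermediate
tensor, no Kronecker powers or degenerations; the algorithm for ⟨q,q,q⟩ is extracted by
Baur–Strassen from a structured determinant computation (FFT polynomial arithmetic), a class the
barrier does not address.
- Literature.Barriers.MatrixMultiplication.UniversalMethodBarrier: not applicable for the same
reason (no CW-type tensor, no monomial degeneration or zeroing-out).
- Literature.Barriers.MatrixMultiplication.UnstableTensorBarrier: not applicable (no fixed starting
tensor of bounded size).
- Literature.Barriers.MatrixMultiplication.RectangularBarrier: not applicable (no dual-exponent /
T-method input).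
- Literature.Barriers.MatrixMultiplication.NilpotentGroupBar

History (route lifecycle, newest last):
- 2026-08-15T16:23:07Z · rev 2: dropped HiddenCornerLemma — repair-ahead in the glue session (planner): HiddenCornerLemma (stmt-MatrixMultiplication-7493, rank-5 negative-side crux, in NEITHER Assembly NOR closes) is ref (planner-rbadge-MatrixMultiplication-HiddenToep-9d5a7c1f-g2-0)
- 2026-08-25T03:41:26Z · DORMANT — reconciler: no traction for 7.3 d (last activity item-evidence-added at 2026-08-17T18:58:51Z); parked, not closed — `ledger route dormant route-MatrixMultiplica (operator:999:3406721)

sub-problem: MatrixMultiplication · status: dormant · opened planner-plancard-MatrixMultiplication-MatrixM-16269a84-0 2026-08-15T12:10:55Z · rev 7 · ledger route-MatrixMultiplication-HiddenToeplitzCorners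
GENERATED by the gate from the ledger (D-0016/17). Provers cite these decls: `theorem foo : Summit.MatrixMultiplication.MatrixMultiplication.Theses.HiddenToeplitzCorners.<Decl> := …` in Summits/MatrixMultiplication/MatrixMultiplication/Theorems/<Name>.lean.
-/

namespace Summit.MatrixMultiplication.MatrixMultiplication.Theses.HiddenToeplitzCorners

open scoped BigOperators Topology Manifold Classical MeasureTheory ProbabilityTheory Matrix InnerProductSpace ComplexConjugate ContinuousMap
open Filter Set Function TopologicalSpace MeasureTheory

attribute [summit_statement] _root_.MatrixMultiplication

/-- item stmt-MatrixMultiplication-7491 · crux · rank 3 · closed · proved by Summit.MatrixMultiplication.MatrixMultiplication.Theorems.ToeplitzLikeDetCost_of @ d0356fbdf7de (prover) · by planner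
why it might fail: In print but never assembled in this form: leading minors of a POLYNOMIAL pencil can vanish identically (the r=2 example has zero diagonal), so preconditioning lives inside the proof; Stein (Z,Zᵀ) vs Pan/Kaltofen's Z_1/Z_0 operators shift d by O(1); XL to formalise.
sources: Pan2001, BitmeadAnderson1980, Kaltofen1994, KaltofenSaunders1991, KarpmanEtAl2021, BostanJeannerodSchost2008
[crux] omega-free superfast elimination, division-free output form (card face F2; second unproved
cone fact): for every ε > 0 and all large r, every pencil T(X) = Σ X_ab T_ab of N x N matrices, N <=
r³, given with split Stein generators T_ab − Z T_ab Zᵀ = G₀ (H₁)_abᵀ + (G₁)_ab H₀ᵀ (G₀, H₀ ∈ ℂ^(N x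
d) constant; s = total number of nonzero entries of the (G₁)_ab, (H₁)_ab), admits a nonzero
polynomial Q with complexity(Q · det T(X)) <= (d²N + s) · r^ε. Proof in print: evaluate generators
(s gates), precondition with constant unit-triangular Toeplitz multipliers for generic rank profile
over ℂ(X) (KaltofenSaunders1991, Kaltofen1994), MBA divide-and-conquer on generators with det read
off the recursive Schur complements in Õ(d²N) ops with division (Pan2001 Cor. 5.3.3,
BitmeadAnderson1980; KarpmanEtAl2021 §1), then numerator/denominator simulation (Strassen1973) gives
a division-free circuit for (P, Q), P = Q·det, of <= 4x the length; logs absorbed in r^ε since N <=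
r³. [difficulty: XL] -/
@[route_item "route-MatrixMultiplication-HiddenToeplitzCorners", crux]
def ToeplitzLikeDetCost : Prop :=
  ∀ ε : ℝ, 0 < ε → ∀ᶠ r : ℕ in Filter.atTop, ∀ (N d : ℕ), N ≤ r ^ 3 → ∀ (T : Fin r → Fin r → Matrix (Fin N) (Fin N) ℂ) (G₀ H₀ : Matrix (Fin N) (Fin d) ℂ) (G₁ H₁ : Fin r → Fin r → Matrix (Fin N) (Fin d) ℂ), (∀ a b, T a b - (Matrix.of fun i j : Fin N => if (i : ℕ) = (j : ℕ) + 1 then (1 : ℂ) else 0) * T a b * (Matrix.of fun i j : Fin N => if (i : ℕ) = (j : ℕ) + 1 then (1 : ℂ) else 0)ᵀ = G₀ * (H₁ a b)ᵀ + G₁ a b * H₀ᵀ) → ∃ Q : MvPolynomial (Fin r × Fin r) ℂ, Q ≠ 0 ∧ (Literature.Computability.AlgebraicComplexity.complexity (Q * (∑ a : Fin r, ∑ b : Fin r, (MvPolynomial.X (a, b) : MvPolynomial (Fin r × Fin r) ℂ) • (T a b).map (MvPolynomial.C : ℂ → MvPolynomial (Fin r × Fin r) ℂ)).det) : ℝ)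 ≤ (((d : ℝ) ^ 2 * N + ∑ a : Fin r, ∑ b : Fin r, ((Finset.univ.filter fun p : Fin N × Fin d => G₁ a b p.1 p.2 ≠ 0).card + (Finset.univ.filter fun p : Fin N × Fin d => H₁ a b p.1 p.2 ≠ 0).card : ℕ)) * (r : ℝ) ^ ε)

/-- item stmt-MatrixMultiplication-7492 · crux · rank 4 · open · by planner
why it might fail: Parameter count: (*) imposes N·r³ bilinear equations on ~r²·N·d unknowns, so generic solvability needs d ≳ r (the r=2 PoC sits exactly on that line) and the card's hidden-corner lemma predicts d >= r/2 for every linearly explained corner: structure would then be exactly neutral.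
sources: KailathKungMorf1979, HeinigRost1984, EisenbudHarris1988, Dieudonne1948, Flanders1962, arXiv:1002.1732
[crux] X itself (card thesis HC for the Toeplitz-like class): for every ε > 0, for infinitely many
r, there is a Toeplitz-like pencil T : M_r(ℂ) → M_N(ℂ), N <= r^(2+ε), with split Stein generators of
length d <= r^ε and sparsity <= r^(2+ε), generically nonsingular, and singular on every singular X.
Any construction via the corner criterion T(X)E = FX (support CornerCriterion) qualifies; the r = 2
honest-Toeplitz instance (N,d) = (4,1) is support ToeplitzCornerTwo; for r >= 3 monomial window
frames provably stop, so non-monomial frames (Toeplitz operators with prescribed structured kernels,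
HeinigRost1984) or two-companion algebras are needed. [deps: AndrewsLifting, ToeplitzLikeDetCost]
[difficulty: open-problem] -/
@[route_item "route-MatrixMultiplication-HiddenToeplitzCorners", crux]
def HiddenCorners : Prop :=
  ∀ ε : ℝ, 0 < ε → ∃ᶠ r : ℕ in Filter.atTop, ∃ (N d : ℕ), (N : ℝ) ≤ (r : ℝ) ^ (2 + ε) ∧ (d : ℝ) ≤ (r : ℝ) ^ ε ∧ ∃ (T : Fin r → Fin r → Matrix (Fin N) (Fin N) ℂ) (G₀ H₀ : Matrix (Fin N) (Fin d) ℂ) (G₁ H₁ : Fin r → Fin r → Matrix (Fin N) (Fin d) ℂ), (∀ a b, T a b - (Matrix.of fun i j : Fin N => if (i : ℕ) = (j : ℕ) + 1 then (1 : ℂ) else 0) * T a b * (Matrix.of fun i j : Fin N => if (i : ℕ) = (j : ℕ) + 1 then (1 : ℂ) else 0)ᵀ = G₀ * (H₁ a b)ᵀ + G₁ a b * H₀ᵀ) ∧ ((∑ a : Fin r, ∑ b : Fin r, ((Finset.univ.filter fun p : Fin N × Fin d => G₁ a b p.1 p.2 ≠ 0).card + (Finset.univ.filter fun p : Fin N ×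 Fin d => H₁ a b p.1 p.2 ≠ 0).card) : ℕ) : ℝ) ≤ (r : ℝ) ^ (2 + ε) ∧ (∃ X₀ : Matrix (Fin r) (Fin r) ℂ, (∑ a : Fin r, ∑ b : Fin r, X₀ a b • T a b).det ≠ 0) ∧ ∀ X : Matrix (Fin r) (Fin r) ℂ, X.det = 0 → (∑ a : Fin r, ∑ b : Fin r, X a b • T a b).det = 0

/-- item stmt-MatrixMultiplication-10752 · crux · rank 5 · open · by planner
why it might fail: Not in print either way: d=1 holds by valuation, but for d>=2 the rank-<=2 displacement spaces include U⊗ℂ^N (dim U=2) and primitive spaces beyond the honest split class, and the Krylov-flag argument leaks (garbage rank ~k·d along Z^k E); a nonsingular witness at (d,r)=(2,5) is the route's loophole.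
sources: Dieudonne1948, Flanders1962, EisenbudHarris1988, arXiv:1002.1732, arXiv:1004.2467, KailathKungMorf1979
[crux] Repaired hidden-corner lemma (negative side, Stein form, NON-DEGENERATE): if a linear pencil
T(X) = Σ X_ab T_ab of N x N complex matrices hides a linearly explained r x r corner — T(X)E = FX
for all X with constant rank-r frames E, F ∈ ℂ^(N x r) — has Stein displacement rank rank(T(X) − Z
T(X) Zᵀ) <= d for every X, AND is generically nonsingular (det T(X₀) ≠ 0 for some X₀, exactly as
HiddenCorners demands), then r <= 2d. Supersedes HiddenCornerLemma (stmt-MatrixMultiplication-7493),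
which omitted nonsingularity and is false as typed: (r,N,d) = (3,9,1), T a b = Z^6 (Zᵀ)^(6+a−3b) (a
Toeplitz block supported on the last three rows, so det T(X) ≡ 0), E = [e8 e5 e2], F = [e8 e7 e6]
(refuter g41-24, sorry-free evidence R7493Mono.lean on stmt-7493, sha256 5663f8ad2c2c4803). Under
nonsingularity the case d = 1 holds for every r >= 2 (one-sided factorisation T(X) = L(u)·U(w(X))
with u₀ ≠ 0 and an s-adic valuation argument on ℂ^N ≅ ℂ[s]/(s^N) force F = 0; refuter note on
stmt-7493); first open case d = 2, r = 5 (the honest-Toeplitz r = 2 PoC has displacement rank 2). A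
proof kills every compression-type (CornerCriterion) construction of HiddenCorners at d = r^(o(1))
and is a new linea -/
@[route_item "route-MatrixMultiplication-HiddenToeplitzCorners"]
def HiddenCornerLemmaR : Prop :=
  ∀ (r N d : ℕ) (T : Fin r → Fin r → Matrix (Fin N) (Fin N) ℂ) (E F : Matrix (Fin N) (Fin r) ℂ), E.rank = r → F.rank = r → (∀ X : Matrix (Fin r) (Fin r) ℂ, (∑ a : Fin r, ∑ b : Fin r, X a b • T a b) * E = F * X) → (∀ X : Matrix (Fin r) (Fin r) ℂ, ((∑ a : Fin r, ∑ b : Fin r, X a b • T a b) - (Matrix.of fun i j : Fin N => if (i : ℕ) = (j : ℕ) + 1 then (1 : ℂ) else 0) * (∑ a : Fin r, ∑ b : Fin r, X a b • T a b) * (Matrix.of fun i j : Fin N => if (i : ℕ) = (j : ℕ) + 1 then (1 : ℂ) else 0)ᵀ).rank ≤ d) → (∃ X₀ : Matrix (Fin r) (Fin r) ℂ, (∑ a : Fin r, ∑ b : Fin r, X₀ a b • T a b).det ≠ 0) → r ≤ 2 * d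

/-- item stmt-MatrixMultiplication-7490 · support · rank 2 · closed · proved by Summit.MatrixMultiplication.MatrixMultiplication.Theorems.andrewsLifting_proof @ 4120aa6a37d9 (prover) · by planner
why it might fail: Published (FOCS 2022, char 0); risk is transcription only: floor r/4 when 4 ∤ r (proof pads the trace ABP, fine), exact-vs-border and gates-vs-product-gates only weaken; a Lean proof needs Andrews–Forbes Lemma 8, the ε-perturbation Prop. and border Baur–Strassen — sizable.
sources: Andrews2022, arXiv:2208.01078, AndrewsForbes2022, BaurStrassen1983, Blaser2013
[crux] Andrews' lifting theorem in tree form (card face F1; the unproved cone fact, filed FIRST per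
Phase-C policy): for every r and every nonzero f ∈ ℂ[X_ij : i,j < r] divisible by det X, the border
rank of ⟨⌊r/4⌋,⌊r/4⌋,⌊r/4⌋⟩ is at most 6 · complexity f, where complexity is the tree's fan-in-two
division-free circuit size (ArithCircuit.lean; it dominates the number of product gates, hence
Andrews' border multiplicative complexity). [difficulty: L] -/
@[route_item "route-MatrixMultiplication-HiddenToeplitzCorners", crux]
def AndrewsLifting : Prop :=
  ∀ (r : ℕ) (f : MvPolynomial (Fin r × Fin r) ℂ), f ≠ 0 → (Matrix.mvPolynomialX (Fin r) (Fin r) ℂ).det ∣ f → Literature.Computability.AlgebraicComplexity.algBorderRank (Literature.Computability.AlgebraicComplexity.matMulTensor ℂ (r / 4) (r / 4) (r / 4)) ≤ 6 * Literature.Computability.AlgebraicComplexity.complexity f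

/-- item stmt-MatrixMultiplication-7494 · support · rank 9 · closed · proved by Summit.MatrixMultiplication.MatrixMultiplication.Theorems.cornerCriterion_proof @ 3bd9dfe8a3c4 (prover) · by planner
sources: Dieudonne1948, Flanders1962
[support] the corner criterion (card, "proved, 3 lines"): if E ∈ ℂ^(N x r) has rank r and T(X)E = FX
for all X, then T(X) is singular whenever X is (a kernel vector v of X gives the kernel vector Ev ≠
0 of T(X)). Provable now (Matrix.rank, mulVec, det = 0 iff non-injective). [difficulty:
provable-now] -/
@[route_item "route-MatrixMultiplication-HiddenToeplitzCorners"]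
def CornerCriterion : Prop :=
  ∀ (r N : ℕ) (T : Fin r → Fin r → Matrix (Fin N) (Fin N) ℂ) (E F : Matrix (Fin N) (Fin r) ℂ), E.rank = r → (∀ X : Matrix (Fin r) (Fin r) ℂ, (∑ a : Fin r, ∑ b : Fin r, X a b • T a b) * E = F * X) → ∀ X : Matrix (Fin r) (Fin r) ℂ, X.det = 0 → (∑ a : Fin r, ∑ b : Fin r, X a b • T a b).det = 0

/-- item stmt-MatrixMultiplication-7495 · support · rank 9 · closed · proved by Summit.MatrixMultiplication.MatrixMultiplication.Theorems.toeplitzCornerTwo_proof @ 098cc084b591 (prover) · by planner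
sources: KailathKungMorf1979, Andrews2022
[support] the r = 2 proof of concept (card PoC, N = 4, F₁ = z, F₂ = z²): the honest Toeplitz pencil
T(X) = [[0,x22,x12,0],[x11,0,x22,x12],[x21,x11,0,x22],[0,x21,x11,0]] has split Stein generators of
length 1 (first row / first column), satisfies T(X)[e₀ e₃] = [e₁ e₂]X, and det T(X) = (det X)²;
verified exactly in this session (5⁴ grid). Anchors HiddenCorners at (r,N,d) = (2,4,1). [difficulty:
provable-now] -/
@[route_item "route-MatrixMultiplication-HiddenToeplitzCorners"]
def ToeplitzCornerTwo : Prop :=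
  ∃ (T : Fin 2 → Fin 2 → Matrix (Fin 4) (Fin 4) ℂ), (∃ (G₀ H₀ : Matrix (Fin 4) (Fin 1) ℂ) (G₁ H₁ : Fin 2 → Fin 2 → Matrix (Fin 4) (Fin 1) ℂ), ∀ a b, T a b - (Matrix.of fun i j : Fin 4 => if (i : ℕ) = (j : ℕ) + 1 then (1 : ℂ) else 0) * T a b * (Matrix.of fun i j : Fin 4 => if (i : ℕ) = (j : ℕ) + 1 then (1 : ℂ) else 0)ᵀ = G₀ * (H₁ a b)ᵀ + G₁ a b * H₀ᵀ) ∧ (∃ E F : Matrix (Fin 4) (Fin 2) ℂ, E.rank = 2 ∧ F.rank = 2 ∧ ∀ X : Matrix (Fin 2) (Fin 2) ℂ, (∑ a : Fin 2, ∑ b : Fin 2, X a b • T a b) * E = F * X) ∧ ∀ X : Matrix (Fin 2) (Fin 2) ℂ, (∑ a : Fin 2, ∑ b : Fin 2, X a b • T a b).det = X.det ^ 2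

/-- item stmt-MatrixMultiplication-7496 · support · rank 9 · closed · proved by Summit.MatrixMultiplication.MatrixMultiplication.Theorems.toeplitzCornerThree_proof @ c156b9d587b4 (prover) · by planner
sources: KailathKungMorf1979, HeinigRost1984, Pan2001
[support] the card's cheapest experiment C1 as a statement (probe, either answer informative): some
Toeplitz-like pencil of honest displacement rank <= 2 and size N <= 12 hides a linearly explained
generic 3 x 3 corner (rank-3 frames E, F with T(X)E = FX, det T(X₀) ≠ 0). For each candidate frame E
the condition is LINEAR in the symbols, so a kit search over ℚ is hours of exact linear algebra; a
witness is Lean-certifiable by the criterion plus one numeric determinant. HiddenCornerLemma permits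
it (3 <= 4), the generic count forbids it. [difficulty: M] -/
@[route_item "route-MatrixMultiplication-HiddenToeplitzCorners"]
def ToeplitzCornerThree : Prop :=
  ∃ N : ℕ, N ≤ 12 ∧ ∃ (T : Fin 3 → Fin 3 → Matrix (Fin N) (Fin N) ℂ) (E F : Matrix (Fin N) (Fin 3) ℂ), E.rank = 3 ∧ F.rank = 3 ∧ (∀ X : Matrix (Fin 3) (Fin 3) ℂ, (∑ a : Fin 3, ∑ b : Fin 3, X a b • T a b) * E = F * X) ∧ (∀ X : Matrix (Fin 3) (Fin 3) ℂ, ((∑ a : Fin 3, ∑ b : Fin 3, X a b • T a b) - (Matrix.of fun i j : Fin N => if (i : ℕ) = (j : ℕ) + 1 then (1 : ℂ) else 0) * (∑ a : Fin 3, ∑ b : Fin 3, X a b • T a b) * (Matrix.of fun i j : Fin N => if (i : ℕ) = (j : ℕ) + 1 then (1 : ℂ) else 0)ᵀ).rank ≤ 2) ∧ ∃ X₀ : Matrix (Fin 3) (Fin 3) ℂ, (∑ a : Fin 3, ∑ b : Fin 3, X₀ a b • T a b).det ≠ 0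

/-- item stmt-MatrixMultiplication-7497 · support · rank 9 · open · by planner
sources: Andrews2022, AndrewsForbes2022
[support] the glue target shared with the companion card's positive face: for every ε > 0, for
infinitely many r, some nonzero f divisible by det X in ℂ[X_ij] has division-free complexity <=
r^(2+ε). (HiddenCorners ∧ ToeplitzLikeDetCost give it via Hilbert's Nullstellensatz for the prime
(det_r), tree file DeterminantIrreducible; with AndrewsLifting it gives ω = 2.) [difficulty:
open-problem] -/
@[route_item "route-MatrixMultiplication-HiddenToeplitzCorners", crux]
def CheapIdealMembers : Prop :=
  ∀ ε : ℝ, 0 < ε → ∃ᶠ r : ℕ in Filter.atTop, ∃ f : MvPolynomial (Fin r × Fin r) ℂ, f ≠ 0 ∧ (Matrix.mvPolynomialX (Fin r) (Fin r) ℂ).det ∣ f ∧ (Literature.Computability.AlgebraicComplexity.complexity f : ℝ) ≤ (r : ℝ) ^ (2 + ε)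

/-- item stmt-MatrixMultiplication-7498 · support · rank 9 · closed · proved by Summit.MatrixMultiplication.MatrixMultiplication.Theorems.costGlue_proof @ 4af2c4d4b598 (prover) · by planner
sources: Andrews2022, Blaser2013
[support] ToeplitzLikeDetCost → HiddenCorners → CheapIdealMembers: take ε' = min(ε,1)/8, an HC
instance at (r, ε') with r past the DetCost threshold for ε'; f := Q · det T(X) is nonzero
(evaluation at X₀, RingHom.map_det) and divisible by det X because det T(X) vanishes on the zero set
of the irreducible det X (Nullstellensatz, MvPolynomial.vanishingIdeal_zeroLocus_eq_radical +
DeterminantIrreducible); cost (d²N + s)·r^ε' <= r^(2+ε). [difficulty: provable-now] -/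
@[route_item "route-MatrixMultiplication-HiddenToeplitzCorners", crux]
def CostGlue : Prop :=
  ToeplitzLikeDetCost → HiddenCorners → CheapIdealMembers

/-- item stmt-MatrixMultiplication-7499 · support · rank 9 · closed · proved by Summit.MatrixMultiplication.MatrixMultiplication.Theorems.liftGlue_proof @ eeba7a06571e (prover) · by planner
sources: Blaser2013, Andrews2022, BurgisserClausenShokrollahi1997
[support] AndrewsLifting → CheapIdealMembers → ω(ℂ) = 2: with q = ⌊r/4⌋ >= 2 and r <= 6q,
bR(⟨q,q,q⟩) <= 6 r^(2+ε) <= 6·6³·q^(2+ε); Bini (Blaser2013_thm66_holds, PROVED) gives ω <=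
log_q(1296) + 2 + ε along an unbounded set of q, hence ω <= 2 + ε for every ε, and omega_two_le
(PROVED) closes ω(ℂ) = 2 = MatrixMultiplication. [difficulty: provable-now] -/
@[route_item "route-MatrixMultiplication-HiddenToeplitzCorners", crux]
def LiftGlue : Prop :=
  AndrewsLifting → CheapIdealMembers → MatrixMultiplication

/-- item stmt-MatrixMultiplication-7500 · assembly · rank 1 · closed · proved by Summit.MatrixMultiplication.MatrixMultiplication.Theorems.hiddenToeplitzCorners_assembly_proof @ 2b7c8b0311b0 (prover) · by planner
sources: Andrews2022, Blaser2013, Pan2001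
[assembly] AndrewsLifting → ToeplitzLikeDetCost → HiddenCorners → MatrixMultiplication (ω(ℂ) = 2). -/
@[route_item "route-MatrixMultiplication-HiddenToeplitzCorners"]
def Assembly : Prop :=
  AndrewsLifting → ToeplitzLikeDetCost → HiddenCorners → MatrixMultiplication

/-! D-0027 §2.1 — DECIDING THEOREM (planner-authored via `route open/edit --closes-file`; by planner-rbadge-MatrixMultiplication-HiddenToep-9d5a7c1f-g2-0 2026-08-15T16:27:10Z):
its hypotheses are this route's items and its conclusion the sub-problem Statement (glue_lint), and it elaborates with this file. -/

/-- **Deciding theorem (D-0027 §2.1) of route HiddenToeplitzCorners.** Pure logic over the route's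
own items: the two ω-free literature cruxes `AndrewsLifting` (Andrews 2022, arXiv:2208.01078 Thm 3:
every nonzero member of the determinantal ideal `(det X_r)` of division-free complexity `s` gives
`bR⟨⌊r/4⌋,⌊r/4⌋,⌊r/4⌋⟩ ≤ 6s`) and `ToeplitzLikeDetCost` (ω-free superfast elimination on
Toeplitz-like pencils, division-free output form `Q · det T(X)`), the thesis `HiddenCorners` (X: a
generic `r × r` corner hides in a Toeplitz-like pencil of size `r^(2+o(1))`, generator length
`r^o(1)`), and the two glue supports `CostGlue : ToeplitzLikeDetCost → HiddenCorners →
CheapIdealMembers` (Nullstellensatz for the prime ideal `(det X_r)` + cost bookkeeping) and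
`LiftGlue : AndrewsLifting → CheapIdealMembers → MatrixMultiplication` (Bini's theorem
`Blaser2013_thm66_holds` + the flattening bound `omega_two_le`, both PROVED in tree). Both supports
are provable now and carry sorry-free candidate proofs as item evidence (P7498.lean on
stmt-MatrixMultiplication-7498, P7499.lean on stmt-MatrixMultiplication-7499); once they land, the
route decides `ω(ℂ) = 2` from the three cruxes alone (`Assembly`). The negative-side crux
`HiddenCornerLemmaR` (non-degenerate hidden-corner lemma) and the probes `CornerCriterion`, `ToeplitzCornerTwo`, `ToeplitzCornerThree`
are deliberately not hypotheses. -/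
@[closes "route-MatrixMultiplication-HiddenToeplitzCorners"] theorem closes (hA : AndrewsLifting) (hT : ToeplitzLikeDetCost) (hH : HiddenCorners)
    (hC : CostGlue) (hL : LiftGlue) : _root_.MatrixMultiplication := by
  -- CheapIdealMembers from the structured-elimination side, then Andrews lifting + Bini
  have hCheap : CheapIdealMembers := hC hT hH
  exact hL hA hCheap

end Summit.MatrixMultiplication.MatrixMultiplication.Theses.HiddenToeplitzCorners
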